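import Summits.MatrixMultiplication.MatrixMultiplication.Theorems.SoloInformedPairStructure

/-!
# Two value-constant rows of `b` pay `n · |K*| · |I ∖ I_exc| ≤ r · |S⁰|` (every chart)

This work, §8.8 (T12) (gen 107), THEOREM 8.16. Setting of `SoloInformedTransfer` (twisted data over the odd part
`G = S¹`, no 2-torsion `hG`, chart into `G₀ = S⁰`, full separation, class map `κ : G → R`, rank `= r · |S⁰|`).

If two rows `j ≠ j'` of `b` are class-constant with INEQUIVALENT classes `[v] ≠ [v']` on a common column set `K*`,
then for every `i` the column `c(·, i)` restricted to `K*` lies in `{[a i j ± v]} ∩ {[a i j' ± v']}`, which is a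
single class unless `a i j' ~ v ∧ a i j ~ v'` (`signEq_of_mem_inter₂`, from the pin lemma
`signEq_pair_of_signEq_add_sub`); so the rows `k ∈ K*` of `c` agree on every non-exceptional column and the third
laziness bound `Data.card_mul_le_of_c_colsOn₂` gives
`Data.card_mul_le_of_two_rows : n · |I₁| · |K*| ≤ r · |S⁰|` for any `I₁` avoiding the exceptional rows.
No poverty, popularity or alignment hypothesis is needed. References: this work §8.8; CohnUmans2013 Def. 12.
-/

namespace Summit.MatrixMultiplication.MatrixMultiplication.Theorems.TwistedTPP

namespace FibreLines

variable {ι G : Type*} [AddCommGroup G]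

/-- **Two-centre intersection lemma.** If `v ≁ v'` and not (`v ~ α'` and `v' ~ α`), any two elements whose classes
lie in `{[α + v], [α - v]} ∩ {[α' + v'], [α' - v']}` are sign-equivalent. [this work, §8.8 (T12)] -/
theorem signEq_of_mem_inter₂ (hG : ∀ x : G, x = -x → x = 0) {α α' v v' y y' : G} (hvv : ¬ SignEq v v')
    (hex : ¬ (SignEq v α' ∧ SignEq v' α))
    (hy : SignEq y (α + v) ∨ SignEq y (α - v)) (hz : SignEq y (α' + v') ∨ SignEq y (α' - v'))
    (hy' : SignEq y' (α + v) ∨ SignEq y' (α - v)) (hz' : SignEq y' (α' + v') ∨ SignEq y' (α' - v')) :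
    SignEq y y' := by
  by_contra hne
  have key : ∀ {a b : G}, SignEq y (α + a) → SignEq y' (α - a) → SignEq y (α' + b) → SignEq y' (α' - b) →
      SignEq a b ∨ (SignEq a α' ∧ SignEq b α) := by
    intro a b ha ha' hb hb'
    rcases signEq_pair_of_signEq_add_sub hG (ha.symm.trans hb) (ha'.symm.trans hb') with ⟨h, -⟩ | h
    · exact Or.inl h
    · exact Or.inr h
  have np : ∀ {u : G}, SignEq y u → SignEq y' u → False := fun ha ha' => hne (ha.trans ha'.symm)
  have finpp : SignEq v v' ∨ (SignEq v α' ∧ SignEq v' α) → False := fun h => h.elim hvv hex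
  have finpm : SignEq v (-v') ∨ (SignEq v α' ∧ SignEq (-v') α) → False := by
    rintro (h | ⟨h1, h2⟩)
    · exact hvv (signEq_neg_right.mp h)
    · exact hex ⟨h1, signEq_neg_left.mp h2⟩
  have finmp : SignEq (-v) v' ∨ (SignEq (-v) α' ∧ SignEq v' α) → False := by
    rintro (h | ⟨h1, h2⟩)
    · exact hvv (signEq_neg_left.mp h)
    · exact hex ⟨signEq_neg_left.mp h1, h2⟩
  have finmm : SignEq (-v) (-v') ∨ (SignEq (-v) α' ∧ SignEq (-v') α) → False := by
    rintro (h | ⟨h1, h2⟩)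
    · exact hvv (signEq_neg_left.mp (signEq_neg_right.mp h))
    · exact hex ⟨signEq_neg_left.mp h1, signEq_neg_left.mp h2⟩
  rcases hy with hy | hy <;> rcases hy' with hy' | hy' <;> rcases hz with hz | hz <;>
    rcases hz' with hz' | hz'
  · exact np hy hy'
  · exact np hy hy'
  · exact np hy hy'
  · exact np hy hy'
  · exact np hz hz'
  · exact finpp (key (a := v) (b := v') hy hy' hz hz')
  · exact finpm (key (a := v) (b := (-v')) hy hy' (by rw [← sub_eq_add_neg]; exact hz) (by rw [sub_neg_eq_add]; exact hz'))
  · exact np hz hz'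
  · exact np hz hz'
  · exact finmp (key (a := (-v)) (b := v') (by rw [← sub_eq_add_neg]; exact hy) (by rw [sub_neg_eq_add]; exact hy') hz hz')
  · exact finmm (key (a := (-v)) (b := (-v')) (by rw [← sub_eq_add_neg]; exact hy) (by rw [sub_neg_eq_add]; exact hy') (by rw [← sub_eq_add_neg]; exact hz) (by rw [sub_neg_eq_add]; exact hz'))
  · exact np hz hz'
  · exact np hy hy'
  · exact np hy hy'
  · exact np hy hy'
  · exact np hy hy'

variable {G₀ R : Type*} [AddCommGroup G₀]

/-- **THEOREM 8.16 (two value-constant rows of `b`, every chart).** If rows `j`, `j'` of `b` are class-constant on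
`K*` with inequivalent classes `v ≁ v'`, and `I₁` avoids the exceptional rows `{i : a i j' ~ v ∧ a i j ~ v'}`, then
`n · |I₁| · |K*| ≤ r · |S⁰|`. [this work, §8.8 (T12)] -/
theorem Data.card_mul_le_of_two_rows [Fintype ι] [DecidableEq ι] [Fintype G₀] [DecidableEq G₀]
    [Fintype R] [DecidableEq R] (hG : ∀ x : G, x = -x → x = 0) (D : Data ι G) (Φ : Chart ι G₀) (κ : G → R)
    (hκ : ∀ x y, κ x = κ y → SignEq x y) (hsep : D.SepAll Φ) {j j' : ι} {v v' : G} (hvv : ¬ SignEq v v')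
    (I₁ Ks : Finset ι) (hj : ∀ k ∈ Ks, SignEq (D.b j k) v) (hj' : ∀ k ∈ Ks, SignEq (D.b j' k) v')
    (hI : ∀ i ∈ I₁, ¬ (SignEq v (D.a i j') ∧ SignEq v' (D.a i j))) :
    Fintype.card ι * I₁.card * Ks.card ≤ Fintype.card R * Fintype.card G₀ := by
  refine D.card_mul_le_of_c_colsOn₂ Φ κ hκ hsep I₁ Ks ?_
  intro k hk k'' hk'' i hi
  have e1 : ∀ k ∈ Ks, SignEq (D.c k i) (D.a i j + v) ∨ SignEq (D.c k i) (D.a i j - v) := fun k hk =>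
    ((D.adm_eqn i j k).of_signEq_mid (hj k hk)).signEq_add_or_sub
  have e2 : ∀ k ∈ Ks, SignEq (D.c k i) (D.a i j' + v') ∨ SignEq (D.c k i) (D.a i j' - v') := fun k hk =>
    ((D.adm_eqn i j' k).of_signEq_mid (hj' k hk)).signEq_add_or_sub
  exact signEq_of_mem_inter₂ hG hvv (hI i hi) (e1 k'' hk'') (e2 k'' hk'') (e1 k hk) (e2 k hk)

/-- **THEOREM 8.16, generic form.** If moreover the class `[v']` occurs at most `m` times in column `j` of `a`
(counted as `#{i : v' = a i j ∨ v' = -a i j} ≤ m`, so at most `m` rows are exceptional), then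
`n · (n - m) · |K*| ≤ r · |S⁰|`. [this work, §8.8 (T12)] -/
theorem Data.card_mul_le_of_two_rows' [Fintype ι] [DecidableEq ι] [Fintype G₀] [DecidableEq G₀]
    [Fintype R] [DecidableEq R] (hG : ∀ x : G, x = -x → x = 0) (D : Data ι G) (Φ : Chart ι G₀) (κ : G → R)
    (hκ : ∀ x y, κ x = κ y → SignEq x y) (hsep : D.SepAll Φ) {j j' : ι} {v v' : G} (hvv : ¬ SignEq v v')
    (Ks : Finset ι) (hj : ∀ k ∈ Ks, SignEq (D.b j k) v) (hj' : ∀ k ∈ Ks, SignEq (D.b j' k) v') (m : ℕ)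
    [DecidableEq G] (hm : (Finset.univ.filter fun i => v' = D.a i j ∨ v' = -D.a i j).card ≤ m) :
    Fintype.card ι * (Fintype.card ι - m) * Ks.card ≤ Fintype.card R * Fintype.card G₀ := by
  classical
  set I₁ : Finset ι := Finset.univ.filter fun i => ¬ (v' = D.a i j ∨ v' = -D.a i j) with hI₁
  have h := D.card_mul_le_of_two_rows hG Φ κ hκ hsep hvv I₁ Ks hj hj'
    (fun i hi hex => by
      rw [hI₁, Finset.mem_filter] at hi
      exact hi.2 hex.2)
  have hcard : Fintype.card ι - m ≤ I₁.card := by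
    have hsum := Finset.card_filter_add_card_filter_not (s := (Finset.univ : Finset ι))
      (fun i => v' = D.a i j ∨ v' = -D.a i j)
    rw [Finset.card_univ] at hsum
    rw [hI₁]
    omega
  calc Fintype.card ι * (Fintype.card ι - m) * Ks.card
      ≤ Fintype.card ι * I₁.card * Ks.card := by gcongr
    _ ≤ Fintype.card R * Fintype.card G₀ := h

end FibreLines

end Summit.MatrixMultiplication.MatrixMultiplication.Theorems.TwistedTPP
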